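import Literature.NumberTheory.Transcendental.PhilipponZeroEstimateMain
import HarnessLib

/-!
# Philippon's zero estimate on `𝔾ₐ × 𝔾ₘ^n` with multiplicities: the discharge

Topic `Literature/NumberTheory/Transcendental`. This file DISCHARGES the named fact
`Literature.NumberTheory.Transcendental.Philippon1986_GaGm` (`PhilipponZeroEstimate.lean`;
Philippon 1986, Théorème 2.1 for `G = 𝔾ₐ × 𝔾ₘ^m`, with multiplicities `T` along an analytic
subgroup `exp_G(W)`): `Philippon1986_GaGm_holds`, with the constant
`c = (m+1)! · 2^{(m+1)²}` (any constant depending only on `m` is allowed by the statement).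

The proof is D. Roy's (Nesterenko–Philippon (eds.), LNM 1752, Ch. 11, Thm. 4.1, pp. 218–220),
assembled from the chain of modules built for it: the descent `GaGm.exists_descent_data`
(`…Main.lean`: `H₀`, the special ideal `𝔄` of the transporter `E`, the cosets `σH₀ ⊆ E ∩ Z(∂^T𝔄)`
as top components); the primes `𝔭_Y = 𝔍(Y)` of these cosets (minimal over `𝔄`, pairwise
incomparable, `u ∉ 𝔭_Y`) and their components `𝔮_Y = loc 𝔭_Y 𝔄`; the multiplicity estimate
`binom(T+s, s) · H_{𝔭_Y}(t) ≤ H_{𝔮_Y}(t + cT)` (Prop. 3.8: `…Step1`, `…Transversal`,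
`…Independence`); thick additivity `∑_Y H_{𝔮_Y}(t-δ) ≤ H_{⋂𝔮_Y}(t)` (`…Loc`); the lossy Bézout bound
`H_𝔍(t) ≤ 2^{(m+1)r} D₀D₁^m (t+1)^{dim E}` for an ideal `𝔍 ≤ ⋂ 𝔮_Y` (`…Chain`, Cohen–Macaulay via
`…Regular`); comparison of leading coefficients (`GaGm.Asymp.sum_le_of_choose_ineq` against the
sandwich `GaGm.HasMult` of the cosets, `mult(σH₀) = mult(H₀) ≥ D₀^{dim V} D₁^{dim T_A}`,
`GaGmSubgroupDegrees`); and the count `#{σH₀} = card((Σ·H₀)/H₀)`.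

## References

* P. Philippon, *Lemmes de zéros dans les groupes algébriques commutatifs*, Bull. Soc. Math.
  France 114 (1986), 355–383, Thm. 2.1; Errata et addenda, ibid. 115 (1987), 397–398.
* Yu. V. Nesterenko, P. Philippon (eds.), *Introduction to Algebraic Independence Theory*,
  LNM 1752, Springer 2001, Ch. 11 (D. Roy), Thm. 4.1.
-/

noncomputable section

open MvPolynomial Module
open scoped Pointwise

namespace Literature.NumberTheory.Transcendental

open GaGm

/-- **Philippon's zero estimate on `𝔾ₐ × 𝔾ₘ^m` with multiplicities** (Philippon 1986, Thm. 2.1;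
Roy, LNM 1752 Ch. 11 Thm. 4.1), discharging `Philippon1986_GaGm` with `c = (m+1)!·2^{(m+1)²}`.
[cite: Philippon1986, Thm 2.1] -/
theorem Philippon1986_GaGm_holds : Philippon1986_GaGm := by
  intro m
  refine ⟨(m + 1).factorial * 2 ^ ((m + 1) * (m + 1)), ?_⟩
  intro D₀ D₁ T W S P hD₀ hD₁ _hW hS h1 hP0 hdeg0 hdeg1 hvan
  classical
  -- `P ∈ Box(1)`
  have hPB : P ∈ Box (n := m) D₀ D₁ 1 := by
    rw [mem_Box_iff, one_mul, one_mul]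
    refine ⟨hdeg0, fun h => ?_⟩
    rw [degreeOf_le_iff]
    intro s hs
    exact (Finset.single_le_sum (fun j _ => Nat.zero_le (s (Fin.succ j))) (Finset.mem_univ h)).trans (hdeg1 s hs)
  -- the descent
  obtain ⟨H₀, hirr, Fgen, v₀, hFgenB, hv₀, hSE, hcosE, hdimcos, hdT, hdimEn⟩ :=
    exists_descent_data W h1 T hP0 hPB hvan
  set 𝔄 : Ideal (MvPolynomial (Fin (m + 1)) ℂ) := sat (Ideal.span Fgen) with h𝔄
  set E : Set (GaGm m) := zeroSet (n := m) (𝔄 : Set (MvPolynomial (Fin (m + 1)) ℂ)) with hE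
  set K := toConnAlgSubgroup H₀ hirr with hK
  have hKH : K.toSubgroup = H₀ := toSubgroup_toConnAlgSubgroup H₀ hirr
  refine ⟨K, ⟨v₀, fun h hh => hv₀ h (by rw [hKH] at hh; exact hh)⟩, ?_⟩
  set s := finrank ℂ W - finrank ℂ ↥(W ⊓ K.tangent) with hs
  set d' := dimG E with hd'
  have hEcl : IsClosedG E := isClosedG_zeroSet _
  have hEeq : E = zeroSet (n := m) Fgen := by rw [hE, h𝔄, zeroSet_sat, zeroSet_span]
  have hvanE : vanishing E = 𝔄.radical := by rw [hEeq, ← zeroSet_span, h𝔄, radical_sat]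
  have h𝔄E : (𝔄 : Set (MvPolynomial (Fin (m + 1)) ℂ)) ⊆ vanishing E := subset_vanishing_zeroSet _
  -- the cosets `Y = σ H₀`, `σ ∈ Σ`
  set 𝓨 : Finset (Set (GaGm m)) := hS.toFinset.image fun σ => σ • (H₀ : Set (GaGm m)) with h𝓨
  have hYrep : ∀ Y ∈ 𝓨, ∃ σ ∈ S, Y = σ • (H₀ : Set (GaGm m)) := fun Y hY => by
    obtain ⟨σ, hσ, rfl⟩ := Finset.mem_image.mp hY
    exact ⟨σ, hS.mem_toFinset.mp hσ, rfl⟩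
  choose! rep hrepS hrepY using hYrep
  have h1𝓨 : (1 : GaGm m) • (H₀ : Set (GaGm m)) ∈ 𝓨 := Finset.mem_image.mpr ⟨1, hS.mem_toFinset.mpr h1, rfl⟩
  haveI : Nonempty ↥𝓨 := ⟨⟨_, h1𝓨⟩⟩
  -- properties of a coset
  have hYirr : ∀ Y : ↥𝓨, IsIrred (Y : Set (GaGm m)) := fun Y => by
    rw [hrepY Y Y.2]; exact hirr.smul _
  have hYE : ∀ Y : ↥𝓨, (Y : Set (GaGm m)) ⊆ E := fun Y => by
    rw [hrepY Y Y.2]; exact hcosE _ (hrepS Y Y.2)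
  have hYdim : ∀ Y : ↥𝓨, dimG (Y : Set (GaGm m)) = d' := fun Y => by
    rw [hrepY Y Y.2]; exact hdimcos _ (hrepS Y Y.2)
  have hYdT : ∀ Y : ↥𝓨, (Y : Set (GaGm m)) ⊆
      zeroSet (n := m) (dIdeal W {(1 : GaGm m)} T 𝔄 : Set (MvPolynomial (Fin (m + 1)) ℂ)) := fun Y => by
    rw [hrepY Y Y.2]; exact hdT _ (hrepS Y Y.2)
  -- the primes
  set 𝔭 : ↥𝓨 → Ideal (MvPolynomial (Fin (m + 1)) ℂ) := fun Y => vanishing (Y : Set (GaGm m)) with h𝔭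
  have h𝔭p : ∀ Y, (𝔭 Y).IsPrime := fun Y => (hYirr Y).2
  have h𝔄le : ∀ Y, 𝔄 ≤ 𝔭 Y := fun Y => fun f hf => vanishing_antitone (hYE Y) (h𝔄E hf)
  have hu : ∀ Y, torusUnit m ∉ 𝔭 Y := fun Y hmem => by
    obtain ⟨y, hy⟩ := (hYirr Y).nonempty
    exact evalAt_torusUnit_ne_zero y (hmem y hy)
  have hmin : ∀ Y, 𝔭 Y ∈ 𝔄.minimalPrimes := fun Y => by
    obtain ⟨𝔮, h𝔮, hYeq⟩ := (hYirr Y).exists_eq_zeroSet_minimalPrimes hEcl (hYE Y) (hYdim Y)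
    have h := (isIrred_zeroSet_of_mem_minimalPrimes h𝔮).2.1
    rw [← hYeq] at h
    rw [← Ideal.radical_minimalPrimes, ← hvanE, show 𝔭 Y = 𝔮 from h]
    exact h𝔮
  have hrad : ∀ Y, ∃ M : ℕ, 𝔭 Y ^ M ≤ loc (𝔭 Y) (h𝔭p Y) 𝔄 := fun Y =>
    exists_pow_le_loc_of_mem_minimalPrimes (hmin Y)
  have hinc : ∀ Y Y' : ↥𝓨, 𝔭 Y ≤ 𝔭 Y' → Y = Y' := fun Y Y' hle => by
    have hsub : (Y' : Set (GaGm m)) ⊆ Y := by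
      rw [← (hYirr Y').isClosedG.eq, ← (hYirr Y).isClosedG.eq]
      exact zeroSet_antitone hle
    have heq := (hYirr Y).eq_of_subset_of_dimG_eq (hYirr Y').isClosedG (hYirr Y').nonempty hsub
      (by rw [hYdim, hYdim])
    exact Subtype.ext heq.symm
  -- the components and the multiplicity estimate at each coset
  have hcount : ∀ Y : ↥𝓨, ∃ cY : ℕ, ∀ t,
      (T + s).choose s * hilbI (n := m) D₀ D₁ ((𝔭 Y).restrictScalars ℂ) t ≤
        hilbI D₀ D₁ ((loc (𝔭 Y) (h𝔭p Y) 𝔄).restrictScalars ℂ) (t + cY * T) := fun Y => by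
    have hdTle : dIdeal W {(1 : GaGm m)} T 𝔄 ≤ 𝔭 Y := fun f hf =>
      vanishing_antitone (hYdT Y) (subset_vanishing_zeroSet _ hf)
    have h𝔄w := wordDeriv_mem_of_dIdeal_le (W := W) hdTle
    obtain ⟨cY, w, g, hwW, hg𝔭, hgB, hoff, hdiag⟩ := exists_transversal H₀ hirr (rep Y) hD₀ hD₁ W
    have hpY : vanishing ((rep Y) • (H₀ : Set (GaGm m))) = 𝔭 Y := by rw [h𝔭]; simp only; rw [← hrepY Y Y.2]
    rw [hpY] at hg𝔭 hoff hdiag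
    exact ⟨cY, fun t => choose_mul_hilbI_le (h𝔭p Y) hg𝔭 hoff hdiag (opPow_mem_of_mem_loc (h𝔭p Y) h𝔄w hwW) hgB t⟩
  choose cY hcY using hcount
  -- the sandwich of each coset
  have hmultY : ∀ Y : ↥𝓨, mult D₀ D₁ (Y : Set (GaGm m)) = mult D₀ D₁ (H₀ : Set (GaGm m)) := fun Y => by
    rw [hrepY Y Y.2]; exact mult_smul hD₀ hD₁ hirr _
  have hsand : ∀ Y : ↥𝓨, ∃ a : ℕ, ∀ t, a ≤ t →
      mult D₀ D₁ (H₀ : Set (GaGm m)) * (t - a + d').choose d' ≤ hilbI (n := m) D₀ D₁ ((𝔭 Y).restrictScalars ℂ) t := by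
    intro Y
    obtain ⟨a, γ, h⟩ := ((hYirr Y).hasMult hD₀ hD₁).1
    refine ⟨a, fun t ht => ?_⟩
    have := (h t ht).1
    rwa [hYdim, hmultY] at this
  choose aY haY using hsand
  -- thick additivity
  obtain ⟨δ, hδ⟩ := exists_sum_hilbI_loc_le hD₀ hD₁ 𝔄 𝔭 h𝔭p hinc h𝔄le hrad Finset.univ
  -- the lossy Bézout bound
  obtain ⟨Fs, hFsF, hspanFs⟩ := exists_finset_span_eq_of_subset_Box hFgenB
  have hFgen𝔄 : Fgen ⊆ (𝔄 : Set (MvPolynomial (Fin (m + 1)) ℂ)) := fun f hf =>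
    le_sat _ (Ideal.subset_span hf)
  have hspanFs𝔄 : Ideal.span (↑Fs : Set (MvPolynomial (Fin (m + 1)) ℂ)) ≤ 𝔄 :=
    Ideal.span_le.mpr (hFsF.trans hFgen𝔄)
  set r' := m + 1 - d' with hr'
  have hr'le : r' ≤ m + 1 := Nat.sub_le _ _
  have hd'le : d' ≤ m := hdimEn
  have hDH : ∀ 𝔭' : Ideal (MvPolynomial (Fin (m + 1)) ℂ), 𝔭'.IsPrime → (∃ Y, 𝔭' ≤ 𝔭 Y) →
      (↑Fs : Set (MvPolynomial (Fin (m + 1)) ℂ)) ⊆ 𝔭' → (r' : ℕ∞) ≤ 𝔭'.height := by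
    rintro 𝔭' h𝔭' ⟨Y, hle⟩ hFs
    have hu' : torusUnit m ∉ 𝔭' := fun h => hu Y (hle h)
    refine le_height_of_dimG_le h𝔭' hu' ((dimG_mono ?_).trans (le_of_eq rfl))
    -- `Z(𝔭') ⊆ Z(Fgen) = E`
    rw [hEeq]
    intro g hg f hf
    have hfspan : f ∈ Submodule.span ℂ (↑Fs : Set (MvPolynomial (Fin (m + 1)) ℂ)) := by
      rw [← hspanFs]; exact Submodule.subset_span hf
    have hf𝔭' : f ∈ 𝔭' := (Submodule.span_le.mpr hFs : Submodule.span ℂ (↑Fs : Set _) ≤ 𝔭'.restrictScalars ℂ) hfspan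
    exact hg f hf𝔭'
  obtain ⟨𝔍, h𝔍le, h𝔍bd⟩ := exists_ideal_hilbI_le 𝔭 h𝔭p Fs r' hDH hD₀ hD₁ hr'le
    (hFsF.trans hFgenB) (fun Y => hFsF.trans (hFgen𝔄.trans (h𝔄le Y)))
  have h𝔍𝔮 : 𝔍 ≤ Finset.univ.inf fun Y => loc (𝔭 Y) (h𝔭p Y) 𝔄 :=
    Finset.le_inf fun Y _ => (h𝔍le Y).trans (loc_mono (h𝔭p Y) hspanFs𝔄)
  -- the comparison of leading coefficients
  set Kb := 2 ^ ((m + 1) * r') * (D₀ * D₁ ^ m) with hKb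
  have hmain : ∀ t, δ + Finset.univ.sup (fun Y => cY Y * T + aY Y) ≤ t →
      ∑ Y ∈ (Finset.univ : Finset ↥𝓨), ((T + s).choose s * mult D₀ D₁ (H₀ : Set (GaGm m))) *
          (t - (δ + cY Y * T + aY Y) + d').choose d' ≤ (Kb * d'.factorial) * (t + 0 + d').choose d' := by
    intro t ht
    have hY : ∀ Y : ↥𝓨, cY Y * T + aY Y ≤ Finset.univ.sup (fun Y => cY Y * T + aY Y) := fun Y =>
      Finset.le_sup (f := fun Y => cY Y * T + aY Y) (Finset.mem_univ Y)
    calc ∑ Y ∈ (Finset.univ : Finset ↥𝓨), ((T + s).choose s * mult D₀ D₁ (H₀ : Set (GaGm m))) *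
          (t - (δ + cY Y * T + aY Y) + d').choose d'
        ≤ ∑ Y ∈ (Finset.univ : Finset ↥𝓨), hilbI (n := m) D₀ D₁ ((loc (𝔭 Y) (h𝔭p Y) 𝔄).restrictScalars ℂ) (t - δ) := by
          refine Finset.sum_le_sum fun Y _ => ?_
          have h1 := haY Y (t - δ - cY Y * T) (by have := hY Y; omega)
          have h2 := hcY Y (t - δ - cY Y * T)
          have e1 : t - δ - cY Y * T - aY Y = t - (δ + cY Y * T + aY Y) := by omega
          have e2 : t - δ - cY Y * T + cY Y * T = t - δ := by have := hY Y; omega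
          rw [e1] at h1
          rw [e2] at h2
          calc (T + s).choose s * mult D₀ D₁ (H₀ : Set (GaGm m)) * (t - (δ + cY Y * T + aY Y) + d').choose d'
              = (T + s).choose s * (mult D₀ D₁ (H₀ : Set (GaGm m)) * (t - (δ + cY Y * T + aY Y) + d').choose d') := by ring
            _ ≤ (T + s).choose s * hilbI (n := m) D₀ D₁ ((𝔭 Y).restrictScalars ℂ) (t - δ - cY Y * T) :=
                Nat.mul_le_mul_left _ h1
            _ ≤ _ := h2
      _ ≤ hilbI D₀ D₁ ((Finset.univ.inf fun Y => loc (𝔭 Y) (h𝔭p Y) 𝔄).restrictScalars ℂ) t := hδ t (by omega)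
      _ ≤ hilbI D₀ D₁ (𝔍.restrictScalars ℂ) t := hilbI_antitone (fun x hx => h𝔍𝔮 hx) t
      _ ≤ Kb * (t + 1) ^ (m + 1 - r') := h𝔍bd t
      _ = Kb * (t + 1) ^ d' := by rw [show m + 1 - r' = d' by omega]
      _ ≤ Kb * (d'.factorial * (t + d').choose d') := Nat.mul_le_mul_left _ (pow_succ_le_factorial_mul_choose t d')
      _ = (Kb * d'.factorial) * (t + 0 + d').choose d' := by rw [Nat.add_zero]; ring
  have hsum := Asymp.sum_le_of_choose_ineq (Finset.univ : Finset ↥𝓨) (Kb * d'.factorial)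
    (fun _ => (T + s).choose s * mult D₀ D₁ (H₀ : Set (GaGm m))) (fun Y => δ + cY Y * T + aY Y) 0 d' _ hmain
  rw [Finset.sum_const, smul_eq_mul, Finset.card_univ, Fintype.card_coe] at hsum
  -- counting the cosets
  have hfib : ∀ x ∈ S, ∀ y ∈ S, (QuotientGroup.mk x : GaGm m ⧸ K.toSubgroup) = QuotientGroup.mk y ↔
      x • (H₀ : Set (GaGm m)) = y • (H₀ : Set (GaGm m)) := by
    intro x _ y _
    rw [QuotientGroup.eq, ← hKH, leftCoset_eq_iff]
  have hncard : Set.ncard ((QuotientGroup.mk : GaGm m → GaGm m ⧸ K.toSubgroup) '' S) = 𝓨.card := by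
    rw [Descent.ncard_image_eq_of_fibres hS _ (fun σ => σ • (H₀ : Set (GaGm m))) hfib,
      show (fun σ => σ • (H₀ : Set (GaGm m))) '' S = ↑𝓨 by rw [h𝓨, Finset.coe_image, hS.coe_toFinset],
      Set.ncard_coe_finset]
  -- the multiplicity of `H₀`
  have hmult := pow_le_mult hD₀ hD₁ H₀ hirr
  rw [← hK] at hmult
  -- the constant
  have hconst : Kb * d'.factorial ≤ (m + 1).factorial * 2 ^ ((m + 1) * (m + 1)) * D₀ * D₁ ^ m := by
    have h1 : d'.factorial ≤ (m + 1).factorial := Nat.factorial_le (by omega)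
    have h2 : 2 ^ ((m + 1) * r') ≤ 2 ^ ((m + 1) * (m + 1)) :=
      Nat.pow_le_pow_right (by norm_num) (Nat.mul_le_mul_left _ hr'le)
    calc Kb * d'.factorial = 2 ^ ((m + 1) * r') * d'.factorial * (D₀ * D₁ ^ m) := by rw [hKb]; ring
      _ ≤ 2 ^ ((m + 1) * (m + 1)) * (m + 1).factorial * (D₀ * D₁ ^ m) :=
          Nat.mul_le_mul_right _ (Nat.mul_le_mul h2 h1)
      _ = (m + 1).factorial * 2 ^ ((m + 1) * (m + 1)) * D₀ * D₁ ^ m := by ring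
  -- assemble
  rw [hncard]
  calc (T + s).choose s * 𝓨.card * D₀ ^ K.addDim * D₁ ^ K.torusDim
      = (T + s).choose s * (D₀ ^ K.addDim * D₁ ^ K.torusDim) * 𝓨.card := by ring
    _ ≤ (T + s).choose s * mult D₀ D₁ (H₀ : Set (GaGm m)) * 𝓨.card :=
        Nat.mul_le_mul_right _ (Nat.mul_le_mul_left _ hmult)
    _ = 𝓨.card * ((T + s).choose s * mult D₀ D₁ (H₀ : Set (GaGm m))) := by ring
    _ ≤ Kb * d'.factorial := hsum
    _ ≤ _ := hconst

end Literature.NumberTheory.Transcendental
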